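import Literature.AlgebraicGeometry.HodgeTheory.AlgebraicClassesExteriorProduct
import Literature.AlgebraicGeometry.HodgeTheory.LefschetzOneOneHolds
import Literature.AlgebraicGeometry.HodgeTheory.AbelianLowDimensionHodgeConjecture
import Literature.AlgebraicGeometry.Milne1999.HodgeCMImpliesTateFiniteFields
import Literature.AlgebraicGeometry.Motives.AbelianVarietyProductDimProofs
import Literature.AlgebraicGeometry.Motives.AbelianVarietyProjectiveChart
import HarnessLib

/-!
# Hodge classes on `A × C`, `C` of CM-type and `A` without simple factors of type IV: the Hodge group splits (Lombardo 2016, §3; Moonen–Zarhin 1999, §3), so the Hodge conjecture for `A × C` follows from the Hodge conjecture for `A` and for CM abelian varieties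

Family `hodge`, layer `Literature/AlgebraicGeometry/HodgeTheory`. Written for the cell `pub-hodge-ring2`
(route seat `motiv`: Mumford–Tate groups / Hodge-ring generation). HONEST FRAMING: research route
conditional on HC_CM; not a corollary; Q11.4-sentence-2 already refuted in dim ≥ 3. (This file uses
no deformation / semiregularity transport at all, so the Q11.4 no-go of
`HodgeTheory/SemiregularityWeakCriterionAbelianCounterexample` does not bear on it.)

## The printed results (quoted verbatim from the held texts)

* D. Lombardo, *On the ℓ-adic Galois representations attached to nonsimple abelian varieties*,
  Ann. Inst. Fourier **66** (2016) 1217–1245 = arXiv:1402.1478, §3 ("Preliminary lemmas"), the lemma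
  numbered 35 in the arXiv text dump `paper:arxiv-1402.1478` p. 8 (fourth lemma of §3; `H(X)` is
  the Hodge group of `X_ℂ`, §2.1: "The Hodge group of `X` is `H(X) = (MT(X) ∩ SL(V(X)))⁰`", defined
  for `X` over an arbitrary subfield of `ℂ`): "Let `K` be a [finitely generated subfield of `ℂ`] and
  `A`, `B` be `K`-abelian varieties. Suppose `B` is of CM type and `A_K̄` has no simple factor of
  type IV. Then we have `H(A × B) ≅ H(A) × H(B)`, and for every prime `ℓ` we also have
  `H_ℓ(A × B) ≅ H_ℓ(A) × H_ℓ(B)`." (Proof there: the projections induce isogenies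
  `H(A × B)^der ≅ H(A)^der` and `Z(H(A × B)) ≅ Z(H(B))`, so `rk H(A × B) = rk H(A) + rk H(B)`, and
  an inclusion of connected reductive groups with surjective projections and full rank is an
  isomorphism, Lemma 32 ibid.; it uses that `H(A)` is semisimple when `A` has no factor of type IV —
  Moonen–Zarhin 1999 §1: "If `X` has no factors of Type 4 then `Hg(X)` is semi-simple" — and that
  `H(B)` is a torus for `B` of CM type. Every complex abelian variety is defined over a finitely
  generated subfield of `ℂ` and `H` only depends on the base change to `ℂ`, so the statement is one
  about pairs of complex abelian varieties.) Lombardo: "certainly well-known to experts (a somewhat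
  similar statement is for example [Imai 1976], which deals with the case of elliptic curves), but
  for lack of an accessible reference we include a short proof".
* B. Moonen, Yu. Zarhin, *Hodge classes on abelian varieties of low dimension*, Math. Ann. **315**
  (1999) 711–733 = arXiv:math/9901113, §3, first paragraph (text dump `paper:arxiv-math_9901113`
  p. 6): "Let `X_1` and `X_2` be complex abelian varieties. Write `X = X_1 × X_2`. Then `Hg(X)` is an
  algebraic subgroup of `Hg(X_1) × Hg(X_2)`. […] We may have that `Hg(X_1 × X_2) ≠ Hg(X_1) × Hg(X_2)`.
  (1) […] This holds if and only if for some `m` and `n` the Hodge ring `B(X_1^m × X_2^n)` is not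
  generated by the elements coming from `B(X_1^m)` and `B(X_2^n)`." (`B = ⊕ B^i`,
  `B^i(X) = H^{2i}(X, ℚ)^{Hg}` the Hodge classes, §1 ibid.) With `m = n = 1`: if the Hodge group of
  `X_1 × X_2` splits, every Hodge class on `X_1 × X_2` is a sum of products `pr_1^* a · pr_2^* b` of
  Hodge classes `a` on `X_1` and `b` on `X_2` (the subring generated by `pr_1^* B(X_1)` and
  `pr_2^* B(X_2)` is spanned by such products, both being rings).
* Tightness (the type-IV hypothesis cannot be dropped), Lombardo loc. cit. Remark 4.6 (p. 1234; Remark 46 of the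
  arXiv text dump, p. 12), after Shioda: there are a simple CM abelian threefold `Y` and a CM elliptic curve `E`
  with `H(Y × E) ≠ H(Y) × H(E)`; by the Moonen–Zarhin criterion some `Y^m × E^n` (both factors again
  of CM type) then carries a Hodge class that is not in the span of products of Hodge classes of
  the factors.

## What is here

* `HasNoTypeIVFactor A` — "no simple factor of (Albert) type IV", rendered on the tree's
  `A.endAlgebra = End⁰(A)`: the centre of `End⁰(A)` is a product of totally real fields, said
  elementwise (every central element is annihilated by a nonzero rational polynomial all of whose
  complex roots are real). For `A ~ ∏ Aᵢ^{nᵢ}` the centre is `∏ Z(End⁰(Aᵢ))`, and `Aᵢ` is of type IV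
  iff its centre is a CM field (Mumford, *Abelian Varieties* §21; Moonen–Zarhin 1999 §1), so this
  is the printed hypothesis.
* `hodgeProductClasses A C p`, `HodgeClassesProductSpan A C` — every rational `(p,p)`-class on
  `A.X ⊗ C.X` lies in the `ℂ`-span of the exterior products `pr_A^* a ∪ pr_C^* b` of rational Hodge
  classes `a ∈ H^{2l}(A)`, `b ∈ H^{2k}(C)`, `l + k = p` (the tree's `cupProduct`, `complexBetti.map`).
* The NAMED FACT `Lombardo2016_hodgeClassesProductSpan` (the two quotations combined):
  `HasNoTypeIVFactor A → IsOfCMType C → HodgeClassesProductSpan A C`.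
* PROVED: `hodgeConjectureFor_tensor_of_productSpan` — `HodgeClassesProductSpan A C`, the Hodge
  conjecture for `A` and for `C` give the Hodge conjecture for `A × C` (exterior products of algebraic
  classes are algebraic: the tree's theorem `cupProduct_map_fst_map_snd_mem_algebraicClasses`,
  Voisin II proof of Prop. 9.20; Hodge models exist: `nonempty_hodgeModel_holds`).
* PROVED, CONDITIONAL ON HC_CM AS A BINDER (`∀ B, Milne1999.CMHodgeHypothesisAt B`, which is the
  summit item `RankFourFaces.CMAbelianHodge` by `Iff.rfl`): `hodgeConjectureFor_prod_of_cmHodgeHypothesis`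
  (`A` without type-IV factor satisfying the Hodge conjecture, `C` of CM type ⟹ HC for `A.prod C`),
  and the closed sub-classes `…_of_dim_le_three` (`dim A ≤ 3`: the tree's unconditional
  `hodgeConjectureFor_of_dim_le_three_holds`) and `…_of_dim_le_five_of` (`dim A ≤ 5`, on the
  unrefereed claim `Markman2025_hodgeClasses_algebraic_abelian_dim_le_five`).
* ON-PATH: `hodgeConjectureFor_prod_of_hodgeConjecture` — each target is a case of the summit
  statement (nothing stronger than the Hodge conjecture is claimed by the targets; the span FACT is
  a statement about Hodge structures and is NOT a consequence of the Hodge conjecture).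
* The tightness fact `Shioda1981_exists_cmType_prod_not_productSpan`.

## What is NOT here (honest content)

In the split case the Hodge classes of `A × C` are products, so HC(`A × C`) ⟺ HC(`A`) ∧ HC(`C`): the
hypothesis HC_CM enters ONLY through the CM factor `C`, and the theorems have content beyond the
refereed record exactly when `C` is a CM abelian variety whose Hodge conjecture is open (dimension
`≥ 6` with exceptional classes; in dimension `≤ 5` Moonen–Zarhin + Markman) and `A` has no
type-IV factor and known HC (dimension `≤ 3` refereed; `≤ 5` on Markman's claim; Hodge ring generated
by divisor classes). Products `A' × C` with `A'` having a NON-CM simple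
factor of type IV whose centre shares a CM field with `C` are NOT covered: there the Hodge group
need not split and the new Hodge classes (Weil-type classes, Moonen–Zarhin 1999 §3 Prop., van
Geemen 1994 §5) are not products of Hodge classes of the factors — that sector needs a transport
input (variational Hodge / semiregularity), not Mumford–Tate groups. No algebraic-group structure on
the tree's `HodgeStructure.hodgeGroup` (a subgroup of `ℚ`-points) is used or asserted: the fact is
vendored at the level of its consequence for Hodge classes.

## References

* [Lombardo2016] D. Lombardo, Ann. Inst. Fourier 66 (2016), no. 3, 1217–1245: Lemma 3.4 (p. 1229) and Remark 4.6 (p. 1234)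
  (= Lemma 35 and Remark 46 of the arXiv:1402.1478 text dump; printed numbering checked on the OA journal text, cell lit/INDEX.md §11).
* [MoonenZarhin1999LowDim] B. Moonen, Yu. Zarhin, Math. Ann. 315 (1999) 711–733: (1.8) condition (D), §3 (3.1) (the splitting
  criterion quoted above), Thm. 3.2 (2) (CM factor, both factors satisfying (D)), Prop. 3.8 (X × E), Cor. 3.9 (Imai), Thm. 2.7 (prime
  dimension); numbering of arXiv:math/9901113, calibrated against the paper's own cross-reference "(3.7)" and Markman's citation of the
  printed "Prop. 3.8" (cell lit/INDEX.md §16).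
* [vanGeemen1994HodgeAV] B. van Geemen, LNM 1594 (1994) 233–252, §4–§5.
* [Hazama1989] F. Hazama, Duke Math. J. 58 (1989), algebraic cycles on nonsimple abelian varieties.
* [Shioda1981FermatTypeAV] T. Shioda, Math. Ann. 258 (1981) 65–80.
* [VoisinHodgeII2003] C. Voisin, Hodge Theory and Complex Algebraic Geometry II, proof of Prop. 9.20.
* [Milne1999] J. S. Milne, Compositio Math. 117 (1999), §7 (the hypothesis HC_CM).
-/

noncomputable section

open CategoryTheory MonoidalCategory CartesianMonoidalCategory
open Literature.AlgebraicTopology.SingularHomology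

namespace Literature.AlgebraicGeometry.HodgeTheory

section HodgeTheory

/-! ### The hypothesis "no simple factor of type IV" and the span statement -/

/-- **`A` has no simple isogeny factor of Albert type IV**, rendered on `End⁰(A) = A.endAlgebra`:
the centre of `End⁰(A)` is a product of totally real number fields, said elementwise — every central
element `z` is a root of a nonzero rational polynomial all of whose complex roots are real. (For
`A ~ ∏ Aᵢ^{nᵢ}` with `Aᵢ` simple pairwise non-isogenous, `Z(End⁰ A) = ∏ Z(End⁰ Aᵢ)`, and `Aᵢ` is of
type IV iff `Z(End⁰ Aᵢ)` is a CM field, of types I–III iff it is totally real.) Lombardo's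
hypothesis "`A_K̄` has no simple factor of type IV"; Moonen–Zarhin §1 "no factors of Type 4". A
predicate (definition, nothing asserted). [cite: MoonenZarhin1999LowDim, §1] -/
def HasNoTypeIVFactor (A : Motives.AbelianVariety ℂ) : Prop :=
  ∀ z ∈ Subalgebra.center ℚ A.endAlgebra, ∃ f : Polynomial ℚ, f ≠ 0 ∧ Polynomial.aeval z f = 0 ∧
    ∀ x : ℂ, Polynomial.aeval x f = 0 → x.im = 0

/-- The **exterior products of rational Hodge classes** on `A × C` in degree `2p`: the classes
`pr_A^* a ∪ pr_C^* b ∈ H^{2p}((A × C)(ℂ); ℂ)` with `a ∈ H^{2l}(A(ℂ); ℂ)` rational of Hodge type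
`(l,l)`, `b ∈ H^{2k}(C(ℂ); ℂ)` rational of Hodge type `(k,k)`, `2l + 2k = 2p` (Moonen–Zarhin 1999
§3: "the elements coming from `B(X_1)` and `B(X_2)`"). [cite: MoonenZarhin1999LowDim, §3] -/
def hodgeProductClasses (A C : Motives.AbelianVariety ℂ) (p : ℕ) :
    Set (complexBetti (A.X ⊗ C.X) (2 * p)) :=
  {x | ∃ (l k : ℕ) (hlk : 2 * l + 2 * k = 2 * p) (a : complexBetti A.X (2 * l))
      (b : complexBetti C.X (2 * k)),
      IsRationalClass a ∧ IsOfHodgeType A.dim A.X (2 * l) l l a ∧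
      IsRationalClass b ∧ IsOfHodgeType C.dim C.X (2 * k) k k b ∧
      x = cupProduct hlk (complexBetti.map (fst A.X C.X) (2 * l) a)
        (complexBetti.map (snd A.X C.X) (2 * k) b)}

/-- **The Hodge classes of `A × C` are spanned by exterior products of Hodge classes of the
factors**: every rational class of Hodge type `(p,p)` in `H^{2p}((A × C)(ℂ); ℂ)` (Hodge types for the
smooth projective `A.X ⊗ C.X` of dimension `dim A + dim C`) lies in the `ℂ`-span of
`hodgeProductClasses A C p` — Moonen–Zarhin 1999 §3: "`B(X_1 × X_2)` is generated by the elements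
coming from `B(X_1)` and `B(X_2)`", which holds when `Hg(X_1 × X_2) = Hg(X_1) × Hg(X_2)`. A predicate
on the pair `(A, C)` (false in general: Shioda's examples). [cite: MoonenZarhin1999LowDim, §3] -/
def HodgeClassesProductSpan (A C : Motives.AbelianVariety ℂ) : Prop :=
  ∀ (p : ℕ) (c : complexBetti (A.X ⊗ C.X) (2 * p)), IsRationalClass c →
    IsOfHodgeType (A.dim + C.dim) (A.X ⊗ C.X) (2 * p) p p c →
    c ∈ Submodule.span ℂ (hodgeProductClasses A C p)

/-! ### The named fact (Lombardo 2016 §3 + Moonen–Zarhin 1999 §3) and its tightness -/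

/-- **Lombardo 2016, Lemma 3.4 (p. 1229; Lemma 35 of arXiv:1402.1478) with Moonen–Zarhin 1999, §3 (3.1)**: if the complex
abelian variety `A` has no simple factor of type IV and `C` is of CM type, then
`Hg(A × C) = Hg(A) × Hg(C)` ("Suppose `B` is of CM type and `A_K̄` has no simple factor of type IV.
Then we have `H(A × B) ≅ H(A) × H(B)`"), hence (Moonen–Zarhin §3, first paragraph, `m = n = 1`) the
Hodge ring of `A × C` is generated by the classes coming from `A` and from `C`: every rational
`(p,p)`-class on `A × C` is in the span of exterior products of rational Hodge classes of `A` and of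
`C`. CM type is Milne's (`Milne1999.IsOfCMType`: a commutative reduced `ℚ`-subalgebra of `End⁰(C)` of
rank `2 dim C`). Proved in print, vendored as a named fact (the tree has no algebraic-group
structure on Hodge groups); a THEOREM in print about Hodge structures, not a consequence of the summit statement. [cite: Lombardo2016, Lemma 3.4 (p. 1229; = Lemma 35 of arXiv:1402.1478)] [cite: MoonenZarhin1999LowDim, §3 (3.1)] -/
def Lombardo2016_hodgeClassesProductSpan : Prop :=
  ∀ (A C : Motives.AbelianVariety ℂ), HasNoTypeIVFactor A → Milne1999.IsOfCMType C →
    HodgeClassesProductSpan A C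

/-- **Tightness: the type-IV hypothesis cannot be dropped** (Shioda 1981; Lombardo 2016, Remark 4.6,
p. 1234 = Remark 46 of arXiv:1402.1478: "there exists a simple CM threefold `Y` and a CM elliptic curve `E` such that
`H(Y × E) ≠ H(Y) × H(E)`"; by Moonen–Zarhin 1999 §3 some `Y^m × E^n` — both factors of CM type,
`Y^m` of type IV — then has Hodge ring not generated by the factors): there are complex abelian
varieties `A`, `C`, both of CM type, with a rational Hodge class on `A × C` outside the span of
exterior products of Hodge classes. Vendored as a named fact. [cite: Lombardo2016, Remark 4.6 (p. 1234; = Remark 46 of arXiv:1402.1478)] [cite: Shioda1981FermatTypeAV, §4] -/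
def Shioda1981_exists_cmType_prod_not_productSpan : Prop :=
  ∃ (A C : Motives.AbelianVariety ℂ), Milne1999.IsOfCMType A ∧ Milne1999.IsOfCMType C ∧
    ¬ HodgeClassesProductSpan A C

/-! ### Proved: products of Hodge classes are algebraic when the factors' Hodge classes are -/

/-- **HC(`A`) ∧ HC(`C`) ∧ (Hodge classes of `A × C` are spanned by products) ⟹ HC(`A × C`)**, for
the scheme `A.X ⊗ C.X` of dimension `dim A + dim C`: a rational `(p,p)`-class is a combination of
`pr_A^* a ∪ pr_C^* b` with `a`, `b` rational Hodge classes, which are algebraic by hypothesis, and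
exterior products of algebraic classes are algebraic (Voisin II, proof of Prop. 9.20, the tree's
`cupProduct_map_fst_map_snd_mem_algebraicClasses`); the Hodge-model conjunct by
`nonempty_hodgeModel_holds` for the smooth projective `A.X ⊗ C.X` (`IsSmoothProjective.tensor_holds`,
`AbelianVariety.isSmoothProjective_holds`). [cite: VoisinHodgeII2003, proof of Prop. 9.20 (first display)] -/
theorem hodgeConjectureFor_tensor_of_productSpan (A C : Motives.AbelianVariety ℂ)
    (hS : HodgeClassesProductSpan A C) (hA : HodgeConjectureFor A.dim A.X)
    (hC : HodgeConjectureFor C.dim C.X) :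
    HodgeConjectureFor (A.dim + C.dim) (A.X ⊗ C.X) := by
  have hAsp : Motives.IsSmoothProjective A.dim A.X := Motives.AbelianVariety.isSmoothProjective_holds
  have hCsp : Motives.IsSmoothProjective C.dim C.X := Motives.AbelianVariety.isSmoothProjective_holds
  have hACsp : Motives.IsSmoothProjective (A.dim + C.dim) (A.X ⊗ C.X) :=
    Motives.IsSmoothProjective.tensor_holds hAsp hCsp
  refine ⟨nonempty_hodgeModel_holds hACsp, fun p c hc hpp ↦ ?_⟩
  refine (Submodule.span_le.mpr ?_) (hS p c hc hpp)
  rintro x ⟨l, k, hlk, a, b, ha, ha', hb, hb', rfl⟩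
  have hp : p = l + k := by omega
  subst hp
  exact cupProduct_map_fst_map_snd_mem_algebraicClasses hAsp hCsp (hA.2 l a ha ha') (hC.2 k b hb hb')

/-- The same for the product abelian variety `A.prod C` (underlying scheme `A.X ⊗ C.X`, dimension
`dim A + dim C` by `AbelianVariety.dim_prod`). [cite: VoisinHodgeII2003, proof of Prop. 9.20 (first display)] -/
theorem hodgeConjectureFor_prod_of_productSpan (A C : Motives.AbelianVariety ℂ)
    (hS : HodgeClassesProductSpan A C) (hA : HodgeConjectureFor A.dim A.X)
    (hC : HodgeConjectureFor C.dim C.X) :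
    HodgeConjectureFor (A.prod C).dim (A.prod C).X := by
  rw [Motives.AbelianVariety.dim_prod]
  exact hodgeConjectureFor_tensor_of_productSpan A C hS hA hC

/-! ### Conditional on HC_CM (a binder): the Hodge conjecture for `A × C`, `C` of CM type -/

/-- **HC_CM ⟹ HC(`A × C`) for `A` without type-IV factor satisfying HC and `C` of CM type**
(ring 2, route `motiv`; HONEST FRAMING: research route conditional on HC_CM; not a corollary;
Q11.4-sentence-2 already refuted in dim ≥ 3 — no transport is used here). Hypotheses: `hCM`, the
Hodge conjecture for all complex CM abelian varieties in Milne's per-variety form (= the summit item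
`RankFourFaces.CMAbelianHodge` by `Iff.rfl`); `hL`, the Lombardo–Moonen–Zarhin span fact. Then for
`A` with `HasNoTypeIVFactor A` and `HodgeConjectureFor A.dim A.X`, and `C` with `IsOfCMType C`, the
Hodge conjecture holds for `A.prod C`: HC(`C`) is `hCM C` (abelian varieties are smooth projective,
`isSmoothProjective_holds`), and `hodgeConjectureFor_prod_of_productSpan` assembles.
[cite: Lombardo2016, Lemma 3.4 (p. 1229; = Lemma 35 of arXiv:1402.1478)] -/
theorem hodgeConjectureFor_prod_of_cmHodgeHypothesis
    (hCM : ∀ B : Motives.AbelianVariety ℂ, Milne1999.CMHodgeHypothesisAt B)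
    (hL : Lombardo2016_hodgeClassesProductSpan) (A C : Motives.AbelianVariety ℂ)
    (hA4 : HasNoTypeIVFactor A) (hCt : Milne1999.IsOfCMType C)
    (hA : HodgeConjectureFor A.dim A.X) :
    HodgeConjectureFor (A.prod C).dim (A.prod C).X :=
  hodgeConjectureFor_prod_of_productSpan A C (hL A C hA4 hCt) hA
    (hCM C Motives.AbelianVariety.isSmoothProjective_holds hCt)

/-- **Closed class (refereed inputs only): `dim A ≤ 3`.** HC_CM and the span fact give the Hodge
conjecture for `A × C` whenever `A` has no type-IV factor and dimension `≤ 3` and `C` is of CM type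
(of any dimension): HC(`A`) is the tree's unconditional `hodgeConjectureFor_of_dim_le_three_holds`
(Lefschetz `(1,1)` + hard Lefschetz; for abelian threefolds also Moonen–Zarhin 1999, Introduction).
Content beyond the record: `C` CM of dimension `≥ 6` with exceptional Hodge classes.
[cite: MoonenZarhin1999LowDim, Introduction and §3] -/
theorem hodgeConjectureFor_prod_of_cmHodgeHypothesis_of_dim_le_three
    (hCM : ∀ B : Motives.AbelianVariety ℂ, Milne1999.CMHodgeHypothesisAt B)
    (hL : Lombardo2016_hodgeClassesProductSpan) (A C : Motives.AbelianVariety ℂ) (hd : A.dim ≤ 3)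
    (hA4 : HasNoTypeIVFactor A) (hCt : Milne1999.IsOfCMType C) :
    HodgeConjectureFor (A.prod C).dim (A.prod C).X :=
  hodgeConjectureFor_prod_of_cmHodgeHypothesis hCM hL A C hA4 hCt
    (hodgeConjectureFor_of_dim_le_three_holds hd Motives.AbelianVariety.isSmoothProjective_holds)

/-- **Class `dim A ≤ 5` on Markman's claim.** With the unrefereed claim
`Markman2025_hodgeClasses_algebraic_abelian_dim_le_five` (arXiv:2509.23403 Cor. 1.3) as a further
binder, HC_CM and the span fact give the Hodge conjecture for `A × C`, `A` without type-IV factor of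
dimension `≤ 5`, `C` of CM type. [claim: Markman2025SurveySecant, status: under-review] -/
theorem hodgeConjectureFor_prod_of_cmHodgeHypothesis_of_dim_le_five_of
    (hM : Markman2025_hodgeClasses_algebraic_abelian_dim_le_five)
    (hCM : ∀ B : Motives.AbelianVariety ℂ, Milne1999.CMHodgeHypothesisAt B)
    (hL : Lombardo2016_hodgeClassesProductSpan) (A C : Motives.AbelianVariety ℂ) (hd : A.dim ≤ 5)
    (hA4 : HasNoTypeIVFactor A) (hCt : Milne1999.IsOfCMType C) :
    HodgeConjectureFor (A.prod C).dim (A.prod C).X :=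
  hodgeConjectureFor_prod_of_cmHodgeHypothesis hCM hL A C hA4 hCt
    (hodgeConjectureFor_abelian_of_dim_le_five_of hM A nonempty_hodgeModel_holds hd
      Motives.AbelianVariety.isSmoothProjective_holds)

/-- **Iterating the CM factor.** Under HC_CM and the span fact, if `A` has no type-IV factor and
satisfies HC, and `C₁`, `C₂` are of CM type with `A.prod C₁` again without type-IV factor — which is
NOT automatic (`C₁` is of type IV unless `dim C₁ = 0`); the hypothesis is explicit — then HC holds for
`(A.prod C₁).prod C₂`. Recorded only to make the shape of the reachable class explicit: one CM block.
[cite: Lombardo2016, Lemma 3.4 (p. 1229; = Lemma 35 of arXiv:1402.1478)] -/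
theorem hodgeConjectureFor_prod_prod_of_cmHodgeHypothesis
    (hCM : ∀ B : Motives.AbelianVariety ℂ, Milne1999.CMHodgeHypothesisAt B)
    (hL : Lombardo2016_hodgeClassesProductSpan) (A C₁ C₂ : Motives.AbelianVariety ℂ)
    (hA4 : HasNoTypeIVFactor A) (hAC4 : HasNoTypeIVFactor (A.prod C₁))
    (hC₁ : Milne1999.IsOfCMType C₁) (hC₂ : Milne1999.IsOfCMType C₂)
    (hA : HodgeConjectureFor A.dim A.X) :
    HodgeConjectureFor ((A.prod C₁).prod C₂).dim ((A.prod C₁).prod C₂).X :=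
  hodgeConjectureFor_prod_of_cmHodgeHypothesis hCM hL (A.prod C₁) C₂ hAC4 hC₂
    (hodgeConjectureFor_prod_of_cmHodgeHypothesis hCM hL A C₁ hA4 hC₁ hA)

/-! ### On-path lemmas: the targets are cases of the Hodge conjecture -/

/-- **On path**: the Hodge conjecture for all smooth projective complex varieties gives the Hodge
conjecture for every product abelian variety `A.prod C` (abelian varieties are smooth projective,
`AbelianVariety.isSmoothProjective_holds`); so every conditional target of this file is a CASE of the
summit statement and claims nothing stronger. [cite: Deligne2000, §1] -/
theorem hodgeConjectureFor_prod_of_hodgeConjecture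
    (h : ∀ ⦃n : ℕ⦄ ⦃X : Motives.SchemeOver ℂ⦄, Motives.IsSmoothProjective n X → HodgeConjectureFor n X)
    (A C : Motives.AbelianVariety ℂ) : HodgeConjectureFor (A.prod C).dim (A.prod C).X :=
  h Motives.AbelianVariety.isSmoothProjective_holds

/-- **On path (HC_CM itself)**: the Hodge conjecture gives Milne's hypothesis at every `B`.
[cite: Milne1999, §7 p. 72] -/
theorem cmHodgeHypothesisAt_of_hodgeConjecture
    (h : ∀ ⦃n : ℕ⦄ ⦃X : Motives.SchemeOver ℂ⦄, Motives.IsSmoothProjective n X → HodgeConjectureFor n X)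
    (B : Motives.AbelianVariety ℂ) : Milne1999.CMHodgeHypothesisAt B :=
  fun hB _ ↦ h hB

/-- **Converse direction of the assembly (sanity on the span statement)**: under
`HodgeClassesProductSpan A C`, every generator `pr_A^* a ∪ pr_C^* b` with `a`, `b` ALGEBRAIC is
algebraic on `A.X ⊗ C.X` unconditionally — the exterior-product theorem applied directly; recorded so
that a reader sees the only non-formal input of `hodgeConjectureFor_tensor_of_productSpan` is the
algebraicity of `a` and `b` themselves. [cite: VoisinHodgeII2003, proof of Prop. 9.20 (first display)] -/
theorem cupProduct_mem_algebraicClasses_prod (A C : Motives.AbelianVariety ℂ) {l k : ℕ}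
    {a : complexBetti A.X (2 * l)} {b : complexBetti C.X (2 * k)}
    (ha : a ∈ algebraicClasses A.X l) (hb : b ∈ algebraicClasses C.X k) :
    cupProduct (two_mul_add_two_mul l k) (complexBetti.map (fst A.X C.X) (2 * l) a)
        (complexBetti.map (snd A.X C.X) (2 * k) b) ∈ algebraicClasses (A.X ⊗ C.X) (l + k) :=
  cupProduct_map_fst_map_snd_mem_algebraicClasses Motives.AbelianVariety.isSmoothProjective_holds
    Motives.AbelianVariety.isSmoothProjective_holds ha hb

/-! ### The hypothesis `HasNoTypeIVFactor` is inhabited whenever the centre of `End⁰(A)` is `ℚ` -/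

/-- **Centre `ℚ` ⟹ no factor of type IV**: if the centre of `End⁰(A) = A.endAlgebra` is reduced to
`ℚ · 1` (e.g. `End⁰(A) = ℚ` — the very general member of any family of polarized abelian varieties —
or `End⁰(A)` a central simple `ℚ`-algebra, types I–III with `F = ℚ` in Albert's classification), then
`HasNoTypeIVFactor A`: a central element `z = q · 1` is a root of `X - q ∈ ℚ[X]`, whose only complex
root `q` is real. Recorded so that the hypothesis of `Lombardo2016_hodgeClassesProductSpan` /
`hodgeConjectureFor_prod_of_cmHodgeHypothesis` is visibly inhabited (review note of the motiv seat,
pub-hodge-ring2). [cite: MoonenZarhin1999LowDim, §1] -/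
theorem hasNoTypeIVFactor_of_center_le_bot {A : Motives.AbelianVariety ℂ}
    (h : Subalgebra.center ℚ A.endAlgebra ≤ ⊥) : HasNoTypeIVFactor A := by
  intro z hz
  obtain ⟨q, rfl⟩ := Algebra.mem_bot.1 (h hz)
  refine ⟨Polynomial.X - Polynomial.C q, Polynomial.X_sub_C_ne_zero q, by simp, fun x hx ↦ ?_⟩
  have hx' : x = (q : ℂ) := by
    have : x - (q : ℂ) = 0 := by simpa using hx
    exact sub_eq_zero.1 this
  simp [hx']

/-- In particular `End⁰(A) = ℚ` (the whole algebra is `⊥`) gives `HasNoTypeIVFactor A`.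
[cite: MoonenZarhin1999LowDim, §1] -/
theorem hasNoTypeIVFactor_of_endAlgebra_eq_bot {A : Motives.AbelianVariety ℂ}
    (h : (⊤ : Subalgebra ℚ A.endAlgebra) = ⊥) : HasNoTypeIVFactor A :=
  hasNoTypeIVFactor_of_center_le_bot (h ▸ le_top)

end HodgeTheory

end Literature.AlgebraicGeometry.HodgeTheory

end
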